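import Mathlib
import HarnessLib
import Summits.ResolutionOfSingularities.ResolutionOfSingularities.Theorems.HomologicalConductorNoZenoCaPrincipalReduction
import Summits.ResolutionOfSingularities.ResolutionOfSingularities.Theorems.HomologicalConductorNoZenoBasePtsFinite

/-!
# Crux `NoZeno` / `NoZenoR` (stmt-ResolutionOfSingularities-16483 / -19943), line `sandwich-cluster`,
# stub S3 `stub_caPrincipalUpstairs` = (Q_val) — Layer 1 (P1.2): reduction to the FIRST infinitely
# near point containing the stage («sky points»)

Route `ResolutionOfSingularities/HomologicalConductor`.  OURS (cell res-hironaka, crux chain W4.4, seat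
res-L0-w44-stub-3); nothing here is a statement of the manuscript under review (Hironaka 2017);
AI-written, weaker than expert review.

After Layer 0 (`caPrincipalUpstairs_of_dominating`): S3 only needs the regular two-dimensional
`S ⊇ T_m` dominating `T_m` and `R`.  By Abhyankar's factorization (`AbhyankarQuadraticFactorization_holds`)
such an `S` is the end of a chain of quadratic transforms `R = Q₀ → Q₁ → ⋯ → Q_L = S`; the FIRST member
`Q_j ⊇ T_m` is again regular, two-dimensional, dominates `T_m` and `R`, and principality of `ca(T_m)·Q_j`
ASCENDS to `S` (the ideal of `S` generated by `ca(T_m)` is the extension of that of `Q_j`).  So it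
suffices to treat the SKY POINTS over `T_m`: `S = R`, or `S` a quadratic transform of some `Q` with
`T_m ⊄ Q` (lead's STUB-PLAN P1.2; P1.3 — «sky points are the closed points of the minimal resolution» —
is geometry, not done here).

* `isRegularLocalRing_and_ringKrullDim_of_reflTransGen` — every member of a chain of quadratic
  transforms from a two-dimensional regular `R₀` to a ring which is not a valuation ring of `K` is
  regular of dimension two (Huneke–Swanson 14.5.2 dichotomy, tree
  `IsQuadraticTransform.isRegularLocalRing_of_not_forall_mem_or_inv_mem`);
* `exists_first_member_ge` — along such a chain ending in `S ⊇ T`, a first member containing `T`;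
* `isPrincipal_span_ca_of_le` — principality of the ideal generated by `ca(T)` ascends along `S' ≤ S`;
* **`caPrincipalUpstairs_of_skyPoints`** — the reduction, binders of the registered stub + hypothesis
  `H` restricted to sky points.

References: S. Abhyankar, Amer. J. Math. 78 (1956), Thm. 3 [`Abhyankar1956Valuations`]; C. Huneke,
I. Swanson, *Integral Closure* (2006), Thm. 14.5.2 [`HunekeSwanson2006`].
-/

noncomputable section

-- single-problem summit: the doubled namespace component `ResolutionOfSingularities` is forced
set_option linter.dupNamespace false

namespace Summit.ResolutionOfSingularities.ResolutionOfSingularities.Theorems.NoZeno.SandwichCluster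

open IsLocalRing Literature.AlgebraicGeometry.Resolution
open Summit.ResolutionOfSingularities.ResolutionOfSingularities.Theorems
open Summit.ResolutionOfSingularities.ResolutionOfSingularities.Theorems.NoZeno.Birth
open Summit.ResolutionOfSingularities.ResolutionOfSingularities.Theses.HomologicalConductor

variable {k K : Type} [Field k] [Field K] [Algebra k K]

/-! ## Members of a chain of quadratic transforms -/

/-- Every member of a chain of quadratic transforms from a two-dimensional regular local ring `R₀` of `K`
to a ring `Q` which is NOT a valuation ring of `K` is a two-dimensional regular local ring of `K`
(by induction along the chain: a valuation ring propagates upwards, and the non-valuation alternative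
of the dichotomy is regular of dimension two). [cite: HunekeSwanson2006, Thm. 14.5.2 (proof)] -/
theorem isRegularLocalRing_and_ringKrullDim_of_reflTransGen {R₀ Q : Subring K}
    (hreg : IsRegularLocalRing ↥R₀) (hdim : ringKrullDim ↥R₀ = 2) (hof : IsLocalRingOf R₀)
    (h : Relation.ReflTransGen IsQuadraticTransform R₀ Q) (hnv : ¬ ∀ z : K, z ∈ Q ∨ z⁻¹ ∈ Q) :
    IsRegularLocalRing ↥Q ∧ ringKrullDim ↥Q = 2 ∧ IsLocalRingOf Q := by
  induction h with
  | refl => exact ⟨hreg, hdim, hof⟩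
  | @tail Q₁ Q₂ h₁ h₂ ih =>
    have hnv₁ : ¬ ∀ z : K, z ∈ Q₁ ∨ z⁻¹ ∈ Q₁ := fun hv =>
      hnv fun z => (hv z).imp (fun hz => h₂.dominates.1 hz) (fun hz => h₂.dominates.1 hz)
    obtain ⟨hreg₁, hdim₁, hof₁⟩ := ih hnv₁
    haveI := hreg₁
    obtain ⟨hreg₂, hdim₂⟩ := h₂.isRegularLocalRing_of_not_forall_mem_or_inv_mem hdim₁ hof₁ hnv
    exact ⟨hreg₂, hdim₂, h₂.isLocalRingOf hof₁⟩

/-- Along a chain of quadratic transforms `R₀ → ⋯ → Q` with `T ≤ Q`, there is a FIRST member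
containing `T`: a member `S'` with `T ≤ S' ≤ Q`, reached from `R₀` and reaching `Q` by quadratic
transforms, which is `R₀` itself or a quadratic transform of a member NOT containing `T`. [folklore] -/
theorem exists_first_member_ge {R₀ Q T : Subring K}
    (h : Relation.ReflTransGen IsQuadraticTransform R₀ Q) (hTQ : T ≤ Q) :
    ∃ S' : Subring K, T ≤ S' ∧ S' ≤ Q ∧ Relation.ReflTransGen IsQuadraticTransform R₀ S' ∧
      Relation.ReflTransGen IsQuadraticTransform S' Q ∧
      (S' = R₀ ∨ ∃ Q₀ : Subring K, Relation.ReflTransGen IsQuadraticTransform R₀ Q₀ ∧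
        IsQuadraticTransform Q₀ S' ∧ ¬ T ≤ Q₀) := by
  induction h with
  | refl => exact ⟨R₀, hTQ, le_rfl, Relation.ReflTransGen.refl, Relation.ReflTransGen.refl, Or.inl rfl⟩
  | @tail Q₁ Q₂ h₁ h₂ ih =>
    by_cases hTQ₁ : T ≤ Q₁
    · obtain ⟨S', hTS', hS'Q₁, hRS', hS'Q, hfirst⟩ := ih hTQ₁
      exact ⟨S', hTS', hS'Q₁.trans h₂.dominates.1, hRS', hS'Q.tail h₂, hfirst⟩
    · exact ⟨Q₂, hTQ, le_rfl, h₁.tail h₂, Relation.ReflTransGen.refl, Or.inr ⟨Q₁, h₁, h₂, hTQ₁⟩⟩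

/-- **Principality ascends.**  For `T ≤ S' ≤ S` (`k`-subalgebras of `K`) the ideal of `S` generated by
`ca(T)` is the extension of the ideal of `S'` generated by `ca(T)`; so if the latter is principal, so is
the former. [folklore] -/
theorem isPrincipal_span_ca_of_le {T S' S : Subalgebra k K} (hTS' : T ≤ S') (hS'S : S' ≤ S)
    (h : (Ideal.span {s : ↥S' | (s : K) ∈ ca T}).IsPrincipal) :
    (Ideal.span {s : ↥S | (s : K) ∈ ca T}).IsPrincipal := by
  set f := (Subalgebra.inclusion hS'S).toRingHom with hf
  have himage : (f : ↥S' → ↥S) '' {s : ↥S' | (s : K) ∈ ca T} = {s : ↥S | (s : K) ∈ ca T} := by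
    ext s
    constructor
    · rintro ⟨s', hs', rfl⟩
      exact hs'
    · intro hs
      have hsT : (s : K) ∈ T := ca_subset T hs
      exact ⟨⟨(s : K), hTS' hsT⟩, hs, Subtype.ext rfl⟩
  have hmap : Ideal.map f (Ideal.span {s : ↥S' | (s : K) ∈ ca T}) =
      Ideal.span {s : ↥S | (s : K) ∈ ca T} := by
    rw [Ideal.map_span, himage]
  obtain ⟨g, hg⟩ := h
  rw [← hmap, hg, Ideal.submodule_span_eq, Ideal.map_span, Set.image_singleton]
  exact ⟨⟨f g, by rw [Ideal.submodule_span_eq]⟩⟩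

/-! ## Layer 1: sky points suffice -/

/-- **Layer 1 of S3 (lead's STUB-PLAN P1.2): sky points suffice.**  With the binders of the
registered stub `stub_caPrincipalUpstairs`: if `ca(T_m)·S` is principal for every regular
two-dimensional `S ⊇ T_m` dominating `T_m` and `R` which is a SKY POINT over `T_m` — `S = R`, or `S` is
a quadratic transform of an infinitely near point `Q` of `R` with `T_m ⊄ Q` — then it is principal for
every regular local `S ⊇ T_m`. [cite: Abhyankar1956Valuations, Thm. 3] -/
theorem caPrincipalUpstairs_of_skyPoints (p : ℕ) (hp : p.Prime) (k K : Type) [Field k] [CharP k p]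
    [Field K] [Algebra k K] (O : ValuationSubring K) (A R : Subalgebra k K) (m₀ : ℕ)
    (ctx : SandwichCtx O A R m₀) (m : ℕ) (hm : m₀ + 1 ≤ m)
    (H : ∀ S : Subalgebra k K, tower O A m ≤ S → IsRegularLocalRing ↥S → ringKrullDim ↥S = 2 →
      (∀ t : K, t ∈ tower O A m → t⁻¹ ∈ S → t⁻¹ ∈ tower O A m) →
      SubringDominates R.toSubring S.toSubring →
      (S = R ∨ ∃ Q : Subring K, Relation.ReflTransGen IsQuadraticTransform R.toSubring Q ∧
        IsQuadraticTransform Q S.toSubring ∧ ¬ (tower O A m).toSubring ≤ Q) →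
      (Ideal.span {s : ↥S | (s : K) ∈ ca (tower O A m)}).IsPrincipal)
    (S : Subalgebra k K) (hTS : tower O A m ≤ S) (hS : IsRegularLocalRing ↥S) :
    (Ideal.span {s : ↥S | (s : K) ∈ ca (tower O A m)}).IsPrincipal := by
  classical
  have hRreg : IsRegularLocalRing ↥R := ctx.2.2.2.2.2.1
  have hRfr : IsFractionRing ↥R K := ctx.2.2.2.2.2.2.1
  haveI := hRreg
  haveI := hRfr
  haveI := isDomain_of_isRegularLocalRing (↥R)
  refine caPrincipalUpstairs_of_dominating p hp k K O A R m₀ ctx m hm ?_ S hTS hS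
  intro S hTS hS hdim hdomT hRS
  haveI := hS
  -- `R` is two-dimensional: otherwise `R`, hence `S`, is a valuation ring of `K`
  have hRK : IsLocalRingOf R.toSubring := isLocalRingOf_toSubring R inferInstance hRfr
  have hSnv : ¬ ∀ z : K, z ∈ S.toSubring ∨ z⁻¹ ∈ S.toSubring := by
    intro hv
    haveI : IsNoetherianRing ↥S.toSubring := (inferInstance : IsNoetherianRing ↥S)
    haveI : IsLocalRing ↥S.toSubring := (inferInstance : IsLocalRing ↥S)
    have h1 : ringKrullDim ↥S.toSubring ≤ 1 :=
      Literature.AlgebraicGeometry.Resolution.ringKrullDim_le_one_of_forall_mem_or_inv_mem hv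
    have h2 : ringKrullDim ↥S ≤ 1 := h1
    rw [hdim] at h2
    exact absurd h2 (by norm_num)
  have hdimR : ringKrullDim ↥R.toSubring = 2 := by
    have hd2 : (maximalIdeal ↥R).spanFinrank ≤ 2 := by
      have h := Literature.RingTheory.KrullDimension.spanFinrank_maximalIdeal_le_trdeg_of_injective
        (k := k) (R := ↥R) (L := K) R.val Subtype.val_injective
      rw [ctx.2.2.2.2.1] at h
      exact_mod_cast h
    rcases Nat.lt_or_ge (maximalIdeal ↥R).spanFinrank 2 with hlt | hge
    · exfalso
      -- `R` is a valuation ring of `K`, hence so is `S ⊇ R`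
      have hdim1 : ringKrullDim ↥R ≤ 1 := by
        rw [Literature.RingTheory.KrullDimension.ringKrullDim_eq_spanFinrank]
        exact_mod_cast (show (maximalIdeal ↥R).spanFinrank ≤ 1 by omega)
      haveI : IsPrincipalIdealRing ↥R := isPrincipalIdealRing_of_ringKrullDim_le_one hdim1
      haveI : ValuationRing ↥R :=
        ((tfae_of_isNoetherianRing_of_isLocalRing_of_isDomain ↥R).out 0 1).mp ‹_›
      apply hSnv
      intro z
      rcases (ValuationRing.iff_isInteger_or_isInteger ↥R K).mp ‹_› z with ⟨r, hr⟩ | ⟨r, hr⟩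
      · left; rw [← hr]; exact hRS.1 r.2
      · right; rw [← hr]; exact hRS.1 r.2
    · have hd : (maximalIdeal ↥R).spanFinrank = 2 := le_antisymm hd2 hge
      have : ringKrullDim ↥R = 2 := by
        rw [Literature.RingTheory.KrullDimension.ringKrullDim_eq_spanFinrank, hd]; rfl
      exact this
  -- Abhyankar: the chain `R → ⋯ → S`; its first member containing `T_m`
  have hchain : Relation.ReflTransGen IsQuadraticTransform R.toSubring S.toSubring :=
    AbhyankarQuadraticFactorization_holds K R.toSubring S.toSubring hRreg hdimR hRK hS hdim hRS
  obtain ⟨S', hTS', hS'S, hRS', hS'Q, hfirst⟩ := exists_first_member_ge hchain (T := (tower O A m).toSubring) hTS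
  -- `S'` is regular of dimension two
  have hS'nv : ¬ ∀ z : K, z ∈ S' ∨ z⁻¹ ∈ S' := fun hv =>
    hSnv fun z => (hv z).imp (fun hz => hS'S hz) (fun hz => hS'S hz)
  obtain ⟨hregS', hdimS', -⟩ :=
    isRegularLocalRing_and_ringKrullDim_of_reflTransGen hRreg hdimR hRK hRS' hS'nv
  -- `S'` as a `k`-subalgebra
  have hRS'le : R.toSubring ≤ S' := (subringDominates_of_reflTransGen hRS').1
  let S'' : Subalgebra k K :=
    { S'.toSubsemiring with algebraMap_mem' := fun c => hRS'le (R.algebraMap_mem c) }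
  have hS''eq : S''.toSubring = S' := rfl
  haveI : IsRegularLocalRing ↥S'' := hregS'
  have hTS'' : tower O A m ≤ S'' := fun z hz => hTS' hz
  have hS''S : S'' ≤ S := fun z hz => hS'S hz
  -- `S` dominates `S'` (iterated quadratic transform); so `S'` dominates `T_m` and `R`
  have hS'dom : SubringDominates S' S.toSubring := subringDominates_of_reflTransGen hS'Q
  have hdomT' : ∀ t : K, t ∈ tower O A m → t⁻¹ ∈ S'' → t⁻¹ ∈ tower O A m :=
    fun t ht hinv => hdomT t ht (hS'S hinv)
  have hRS'' : SubringDominates R.toSubring S''.toSubring :=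
    ⟨hRS'le, fun r hr hinv => hRS.2 r hr (hS'S hinv)⟩
  have hsky : S'' = R ∨ ∃ Q : Subring K, Relation.ReflTransGen IsQuadraticTransform R.toSubring Q ∧
      IsQuadraticTransform Q S''.toSubring ∧ ¬ (tower O A m).toSubring ≤ Q := by
    rcases hfirst with h | ⟨Q₀, hRQ₀, hQ₀S', hTQ₀⟩
    · left
      exact Subalgebra.toSubring_injective (by rw [hS''eq, h])
    · right
      exact ⟨Q₀, hRQ₀, hQ₀S', hTQ₀⟩
  have hprin := H S'' hTS'' hregS' hdimS' hdomT' hRS'' hsky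
  exact isPrincipal_span_ca_of_le hTS'' hS''S hprin

end Summit.ResolutionOfSingularities.ResolutionOfSingularities.Theorems.NoZeno.SandwichCluster

end
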